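/-
Copyright (c) 2026. All rights reserved.
Released under Apache 2.0 license as described in the file LICENSE.
-/
import Mathlib
import Summits.RiemannHypothesis.RiemannHypothesis.Theorems.HandoffSlavedELSteps
import Summits.RiemannHypothesis.RiemannHypothesis.Theorems.HandoffSlavedELBand
import Literature.Probability.LatticeModels.DiscreteExtremalLengthExternalArcsSelfDual
import HarnessLib

/-!
# L-EL: the Euler–Lagrange characterisation of SLAVED completions

`HANDOFF/prove-1` gen15, ATTEMPT-22 §6 (S22-d) / idea-1 IDEAS-prolate §131.3 «L-EL». Assembly of
`HandoffSlavedELSteps` (Steps 1, 3a, 4), `HandoffSlavedELBand` (Step 3b) and the tree's Step 2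
(`DiscreteRect.eq_zero_of_forall_le_add_quad`):

  **`slaved_inner_ae_eq_bandLimit_add_const`** — if `F ∈ L¹ ∩ L²(ℝ)` is even and SLAVED at
  bandwidth `λ > 0` (its leakage `∫_{|ξ|≥λ} |𝓕F|²` does not decrease under any even, mean-zero
  `L¹ ∩ L²` perturbation supported in the inner zone `I = (-1/λ, 1/λ)`), then on `I`, almost
  everywhere, `F = D_λF + α` for a constant `α`, where `D_λF = 𝓕⁻(1_{|ξ|<λ}·𝓕F)` is the band-limited
  part of `F`.

All hypotheses are inlined (no new definitions). Existence of slaved completions is NOT addressed.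
RH-free; nothing here bears on the truth of RH.
-/

set_option linter.dupNamespace false

noncomputable section

open MeasureTheory Set Complex
open scoped FourierTransform

namespace Summit.RiemannHypothesis.RiemannHypothesis.Theorems

namespace LatticeUncertainty.SlavedEL

/-- The Fourier transform of an even integrand is even. -/
theorem fourier_even {h : ℝ → ℂ} (heven : ∀ v, h (-v) = h v) (w : ℝ) : 𝓕 h (-w) = 𝓕 h w := by
  rw [Real.fourier_eq, Real.fourier_eq, ← integral_neg_eq_self]
  refine integral_congr_ae (ae_of_all _ fun v ↦ ?_)
  simp only [inner_neg_neg, heven]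

/-- The band-limited part `𝓕⁻(1_{|ξ|<λ}·𝓕F)` of an even `F` is even. -/
theorem bandLimit_even {F : ℝ → ℂ} (heven : ∀ x, F (-x) = F x) (lam x : ℝ) :
    𝓕⁻ ({ξ : ℝ | |ξ| < lam}.indicator (𝓕 F)) (-x) = 𝓕⁻ ({ξ : ℝ | |ξ| < lam}.indicator (𝓕 F)) x := by
  have hh : ∀ v, {ξ : ℝ | |ξ| < lam}.indicator (𝓕 F) (-v) = {ξ : ℝ | |ξ| < lam}.indicator (𝓕 F) v := by
    intro v
    have hmem : (-v ∈ {ξ : ℝ | |ξ| < lam}) ↔ (v ∈ {ξ : ℝ | |ξ| < lam}) := by simp [abs_neg]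
    by_cases hv : v ∈ {ξ : ℝ | |ξ| < lam}
    · rw [indicator_of_mem hv, indicator_of_mem (hmem.mpr hv), fourier_even heven]
    · rw [indicator_of_notMem hv, indicator_of_notMem (fun h' ↦ hv (hmem.mp h'))]
  rw [Real.fourierInv_eq_fourier_neg, Real.fourierInv_eq_fourier_neg, neg_neg, fourier_even hh]

/-- **L-EL.** A slaved even `F ∈ L¹ ∩ L²` equals its band-limited part plus a constant, a.e. on the
inner zone `(-1/λ, 1/λ)`. -/
theorem slaved_inner_ae_eq_bandLimit_add_const {lam : ℝ} (hlam : 0 < lam) {F : ℝ → ℂ}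
    (heven : ∀ x, F (-x) = F x) (hF : Integrable F) (hF2 : MemLp F 2)
    (hslaved : ∀ k : ℝ → ℂ, (∀ x, k (-x) = k x) →
      Function.support k ⊆ Ioo (-(1 / lam)) (1 / lam) → ∫ x, k x = 0 → Integrable k →
      MemLp k 2 → leakage lam F ≤ leakage lam (F + k)) :
    ∃ α : ℂ, ∀ᵐ x ∂(volume.restrict (Ioo (-(1 / lam)) (1 / lam))),
      F x = 𝓕⁻ ({ξ : ℝ | |ξ| < lam}.indicator (𝓕 F)) x + α := by
  set B : Set ℝ := {ξ : ℝ | |ξ| < lam} with hBdef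
  have hB : MeasurableSet B := measurableSet_lt (continuous_abs.measurable) measurable_const
  have hBc : Bᶜ = {ξ : ℝ | lam ≤ |ξ|} := by ext ξ; simp [hBdef, not_lt]
  set D : ℝ → ℂ := 𝓕⁻ (B.indicator (𝓕 F)) with hDdef
  set I : Set ℝ := Ioo (-(1 / lam)) (1 / lam) with hIdef
  -- the band piece and `D`
  have hhi : Integrable (B.indicator (𝓕 F)) := integrable_band_fourier hF lam
  have hDcont : Continuous D := by
    have : D = fun x ↦ 𝓕 (B.indicator (𝓕 F)) (-x) := by
      ext x; rw [hDdef, Real.fourierInv_eq_fourier_neg]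
    rw [this]
    exact (Literature.Analysis.FunctionSpaces.continuous_fourierIntegral hhi).comp continuous_neg
  have hDb : ∀ x, ‖D x‖ ≤ ∫ v, ‖B.indicator (𝓕 F) v‖ := fun x ↦ by
    rw [hDdef, Real.fourierInv_eq_fourier_neg]
    exact VectorFourier.norm_fourierIntegral_le_integral_norm _ _ _ _ _
  -- STEP A: `∫_{Bᶜ} conj(𝓕F)𝓕k = 0` for every inner `k`
  have stepA : ∀ k : ℝ → ℂ, (∀ x, k (-x) = k x) → Function.support k ⊆ I → ∫ x, k x = 0 →
      Integrable k → MemLp k 2 → ∫ ξ in Bᶜ, starRingEnd ℂ (𝓕 F ξ) * 𝓕 k ξ = 0 := by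
    -- real part for every inner k
    have re_part : ∀ k : ℝ → ℂ, (∀ x, k (-x) = k x) → Function.support k ⊆ I → ∫ x, k x = 0 →
        Integrable k → MemLp k 2 → (∫ ξ in Bᶜ, starRingEnd ℂ (𝓕 F ξ) * 𝓕 k ξ).re = 0 := by
      intro k hke hks hkm hki hk2
      refine Literature.Probability.LatticeModels.DiscreteRect.eq_zero_of_forall_le_add_quad
        (a := leakage lam F) (c := leakage lam k) fun t ↦ ?_
      have hq := leakage_add_mul lam hF hF2 hki hk2 t
      rw [← hBc] at hq
      rw [← hq]
      refine hslaved _ (fun x ↦ by simp [hke x]) ?_ ?_ (hki.const_mul _) (hk2.const_mul _)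
      · exact (Function.support_mul_subset_right _ _).trans hks
      · rw [integral_const_mul, hkm, mul_zero]
    intro k hke hks hkm hki hk2
    set Z := ∫ ξ in Bᶜ, starRingEnd ℂ (𝓕 F ξ) * 𝓕 k ξ with hZ
    have h1 : Z.re = 0 := re_part k hke hks hkm hki hk2
    -- imaginary part from `I • k`
    have h2 := re_part (fun x ↦ Complex.I * k x) (fun x ↦ by simp [hke x])
      ((Function.support_mul_subset_right _ _).trans hks)
      (by rw [integral_const_mul, hkm, mul_zero]) (hki.const_mul _) (hk2.const_mul _)
    have hsm : 𝓕 (fun x ↦ Complex.I * k x) = fun ξ ↦ Complex.I * 𝓕 k ξ := by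
      have := VectorFourier.fourierIntegral_const_smul Real.fourierChar volume (innerₗ ℝ) k
        Complex.I
      ext ξ; exact congrFun this ξ
    have h3 : ∫ ξ in Bᶜ, starRingEnd ℂ (𝓕 F ξ) * 𝓕 (fun x ↦ Complex.I * k x) ξ = Complex.I * Z := by
      rw [hZ, ← integral_const_mul]
      refine integral_congr_ae (ae_of_all _ fun ξ ↦ ?_)
      simp only; rw [hsm]; ring
    rw [h3, Complex.I_mul_re, neg_eq_zero] at h2
    exact Complex.ext h1 h2
  -- STEP B: `∫ conj(F − D)·k = 0` for every inner `k`
  have sF : Integrable (fun x ↦ ‖F x‖ ^ 2) := (memLp_two_iff_integrable_sq_norm hF2.1).mp hF2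
  have stepB : ∀ k : ℝ → ℂ, (∀ x, k (-x) = k x) → Function.support k ⊆ I → ∫ x, k x = 0 →
      Integrable k → MemLp k 2 → ∫ x, starRingEnd ℂ (F x - D x) * k x = 0 := by
    intro k hke hks hkm hki hk2
    have sk : Integrable (fun x ↦ ‖k x‖ ^ 2) := (memLp_two_iff_integrable_sq_norm hk2.1).mp hk2
    have hg : Integrable (fun ξ ↦ starRingEnd ℂ (𝓕 F ξ) * 𝓕 k ξ) :=
      integrable_conj_fourier_mul hF hF2 hki hk2
    have hsplit := integral_add_compl hB hg
    rw [stepA k hke hks hkm hki hk2, add_zero, integral_conj_fourier_mul_eq hF hF2 hki hk2,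
      integral_band_conj_fourier_mul_eq hF hki lam] at hsplit
    -- integrability on the x-side
    have iFk : Integrable (fun x ↦ starRingEnd ℂ (F x) * k x) :=
      integrable_conj_mul_of_sq hF.aestronglyMeasurable hki.aestronglyMeasurable sF sk
    have iDk : Integrable (fun x ↦ starRingEnd ℂ (D x) * k x) := by
      refine Integrable.mono' (hki.norm.const_mul (∫ v, ‖B.indicator (𝓕 F) v‖))
        ((Complex.continuous_conj.comp hDcont).aestronglyMeasurable.mul hki.aestronglyMeasurable)
        (ae_of_all _ fun x ↦ ?_)
      rw [norm_mul, Complex.norm_conj]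
      exact mul_le_mul_of_nonneg_right (hDb x) (norm_nonneg _)
    have : ∫ x, starRingEnd ℂ (F x - D x) * k x =
        (∫ x, starRingEnd ℂ (F x) * k x) - ∫ x, starRingEnd ℂ (D x) * k x := by
      rw [← integral_sub iFk iDk]
      refine integral_congr_ae (ae_of_all _ fun x ↦ ?_)
      simp only [map_sub]; ring
    rw [this, ← hsplit, sub_self]
  -- STEP C: the averaging step
  have hHeven : ∀ x, (F (-x) - D (-x)) = F x - D x := fun x ↦ by
    rw [heven, hDdef, bandLimit_even heven lam x]
  have hIfin : volume I < ⊤ := by simp [hIdef]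
  have hH2 : MemLp (I.indicator fun x ↦ F x - D x) 2 := by
    rw [memLp_indicator_iff_restrict measurableSet_Ioo]
    haveI : IsFiniteMeasure (volume.restrict I) := ⟨by simpa using hIfin⟩
    have hDmem : MemLp D 2 (volume.restrict I) :=
      MemLp.of_bound hDcont.aestronglyMeasurable _ (ae_of_all _ fun x ↦ hDb x)
    exact (hF2.restrict I).sub hDmem
  obtain ⟨α, hα⟩ := ae_eq_const_of_orthogonal_inner hlam hHeven hH2
    (fun k hke hks hkm hki hk2 ↦ stepB k hke hks hkm hki hk2)
  exact ⟨α, hα.mono fun x hx ↦ by rw [← hx]; ring⟩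

end LatticeUncertainty.SlavedEL

end Summit.RiemannHypothesis.RiemannHypothesis.Theorems
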